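import Summits.Ventures.Crystal3D.Theorems.StickyWulffConstantGenericWallFloorSliverFree
import Summits.Ventures.Crystal3D.Theorems.StickyWulffConstantGenericWallFloorTopCredits
import HarnessLib

/-!
# Outer credits without the clean-sliver hypothesis

HONEST FRAMING. Venture `Summits/Ventures/Crystal3D` (cell `crystal3d-full`), helper for the crux
`GenericWallFloor` (stmt-Ventures-19480) of `route-Ventures-StickyWulffConstant`, REGISTERED line `WallLedgerG`,
open stub `stub_twoSlabAdhesion`.  Rung credit only; F-C1 not moved.

The four outer-credit lemmas of `…GrainCredits` / `…TopCredits` with the clean-sliver hypothesis replaced by the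
cell's height bound (`−2R₀ ≤ p₂`, resp. `p₂ ≤ h + 2R₀`), via the sliver-free sealing of `…SliverFree`:
`foreign_high_or_rim'`, `not_outerCredit_of_foreign'`, `foreign_low_or_rim_top'`, `not_outerCredit_of_foreign_top'`.
Proof bodies otherwise verbatim.  WHAT THIS IS NOT: not the stub; F-C1 not moved.
-/

noncomputable section

namespace Summit.Ventures.Crystal3D.Theorems

open Summit.Ventures.Crystal3D Finset
open Literature.MathematicalPhysics.StatisticalMechanics (fccStacking barlowStacking constHagg)
open scoped InnerProductSpace

/-- **A foreign ball is high or in the rim zone (sliver-free).**  With the slab sample complete in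
`[−2R₀, −R₀] × disc ρ` (`ρ ≥ 1`), `X ⊇ P` `1`-separated and the clean outer sliver, a ball `q ∈ X` off
the grain has `q₂ > −R₀ − 1` or `(ρ − 1)² < q₀² + q₁²`. -/
theorem foreign_high_or_rim'
    (A : EuclideanSpace ℝ (Fin 3) ≃ₗᵢ[ℝ] EuclideanSpace ℝ (Fin 3)) (t : EuclideanSpace ℝ (Fin 3))
    (X P : Finset (EuclideanSpace ℝ (Fin 3))) (R₀ ρ : ℝ) (hρ : 1 ≤ ρ)
    (hX : ∀ p ∈ X, ∀ q ∈ X, p ≠ q → 1 ≤ dist p q) (hPX : P ⊆ X)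
    (hP : ∀ p, p ∈ P ↔ (p ∈ (fun q => A q + t) '' fccStacking 1 (Real.sqrt (2 / 3)) ∧
      -(2 * R₀) ≤ p 2 ∧ p 2 ≤ -R₀ ∧ p 0 ^ 2 + p 1 ^ 2 ≤ ρ ^ 2))
    (hcell : ∀ p ∈ X, -(2 * R₀) ≤ p 2)
    {q : EuclideanSpace ℝ (Fin 3)} (hqX : q ∈ X)
    (hqΛ : q ∉ (fun q => A q + t) '' fccStacking 1 (Real.sqrt (2 / 3))) :
    -R₀ - 1 < q 2 ∨ (ρ - 1) ^ 2 < q 0 ^ 2 + q 1 ^ 2 := by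
  by_contra hcon
  push Not at hcon
  obtain ⟨hq2, hqr⟩ := hcon
  have hmem := mem_sample_bottom_of_deep' A t X P R₀ ρ hρ hX hPX hcell hP hqX hq2 hqr
  exact hqΛ ((hP q).1 hmem).1

/-- **(Sliver-free.) A non-rim sample ball touching a foreign ball carries no outer credit** (`R₀ ≥ 3`): for every
slot `w` with `⟪A w, e₃⟫ ≤ 0`, `p + A w ∈ P`. -/
theorem not_outerCredit_of_foreign'
    (A : EuclideanSpace ℝ (Fin 3) ≃ₗᵢ[ℝ] EuclideanSpace ℝ (Fin 3)) (t : EuclideanSpace ℝ (Fin 3))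
    (X P : Finset (EuclideanSpace ℝ (Fin 3))) (R₀ ρ : ℝ) (hR₀ : 3 ≤ R₀) (hρ : R₀ ≤ ρ)
    (hX : ∀ p ∈ X, ∀ q ∈ X, p ≠ q → 1 ≤ dist p q) (hPX : P ⊆ X)
    (hP : ∀ p, p ∈ P ↔ (p ∈ (fun q => A q + t) '' fccStacking 1 (Real.sqrt (2 / 3)) ∧
      -(2 * R₀) ≤ p 2 ∧ p 2 ≤ -R₀ ∧ p 0 ^ 2 + p 1 ^ 2 ≤ ρ ^ 2))
    (hcell : ∀ p ∈ X, -(2 * R₀) ≤ p 2)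
    {p q : EuclideanSpace ℝ (Fin 3)} (hp : p ∈ P) (hprim : p 0 ^ 2 + p 1 ^ 2 ≤ (ρ - 2) ^ 2)
    (hqX : q ∈ X) (hqΛ : q ∉ (fun q => A q + t) '' fccStacking 1 (Real.sqrt (2 / 3)))
    (hpq : dist p q = 1)
    {w : EuclideanSpace ℝ (Fin 3)} (hw : w ∈ fccSlots)
    (hα : ⟪A w, EuclideanSpace.single (2 : Fin 3) (1 : ℝ)⟫_ℝ ≤ 0) : p + A w ∈ P := by
  have hρ1 : (1 : ℝ) ≤ ρ := by linarith
  have hρ2 : (0 : ℝ) ≤ ρ - 2 := by linarith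
  obtain ⟨hpΛ, hp1, hp2, hp3⟩ := (hP p).1 hp
  -- lateral radius of `p` and of `p + A w`
  have hsp : Real.sqrt (p 0 ^ 2 + p 1 ^ 2) ≤ ρ - 2 := by
    rw [← Real.sqrt_sq hρ2]; exact Real.sqrt_le_sqrt hprim
  have hlatw : (p + A w) 0 ^ 2 + (p + A w) 1 ^ 2 ≤ ρ ^ 2 := by
    have h1 := sqrt_lateral_add_le p (A w)
    rw [LinearIsometryEquiv.norm_map, norm_eq_one_of_mem_fccSlots hw] at h1
    have h2 : Real.sqrt ((p + A w) 0 ^ 2 + (p + A w) 1 ^ 2) ≤ ρ := by linarith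
    have h3 := Real.sq_sqrt (by positivity : (0 : ℝ) ≤ (p + A w) 0 ^ 2 + (p + A w) 1 ^ 2)
    nlinarith [Real.sqrt_nonneg ((p + A w) 0 ^ 2 + (p + A w) 1 ^ 2)]
  -- where is `q`?  high (then `p` is high) or in the rim (then `p` is a rim ball)
  rcases foreign_high_or_rim' A t X P R₀ ρ hρ1 hX hPX hP hcell hqX hqΛ with hq2 | hqr
  · -- `p₂ > −R₀ − 2`, so `p + A w` is still inside the window
    have hpz : -R₀ - 2 < p 2 := by
      have := abs_apply_sub_le_dist p q 2
      rw [hpq] at this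
      have := (abs_le.1 this).1
      linarith
    have hα1 : -1 ≤ ⟪A w, EuclideanSpace.single (2 : Fin 3) (1 : ℝ)⟫_ℝ :=
      (abs_le.1 (abs_inner_slot_le_one A hw)).1
    have e2 : (p + A w) 2 = p 2 + ⟪A w, EuclideanSpace.single (2 : Fin 3) (1 : ℝ)⟫_ℝ := by
      rw [PiLp.add_apply, apply_two_eq_inner_e₃ (A w)]
    rw [hP]
    refine ⟨movedFcc_add_site_mem A t hpΛ (mem_fcc_of_mem_fccSlots hw), ?_, ?_, hlatw⟩
    · rw [e2]; linarith
    · rw [e2]; linarith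
  · -- `q` in the rim zone forces `p` to be a rim ball: contradiction
    exfalso
    have h1 := lateral_radius_le_add_dist q p
    rw [dist_comm, hpq] at h1
    have hq : ρ - 1 < Real.sqrt (q 0 ^ 2 + q 1 ^ 2) := by
      rw [← Real.sqrt_sq (by linarith : (0 : ℝ) ≤ ρ - 1)]
      exact Real.sqrt_lt_sqrt (sq_nonneg _) hqr
    linarith

/-- **A foreign ball is low or in the rim zone (top sample, sliver-free).**  With the top sample complete in
`[h + R₀, h + 2R₀] × disc ρ` (`ρ ≥ 1`), `X ⊇ P` `1`-separated and the clean TOP sliver, a ball `q ∈ X`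
off the grain has `q₂ < h + R₀ + 1` or `(ρ − 1)² < q₀² + q₁²`. -/
theorem foreign_low_or_rim_top'
    (A : EuclideanSpace ℝ (Fin 3) ≃ₗᵢ[ℝ] EuclideanSpace ℝ (Fin 3)) (t : EuclideanSpace ℝ (Fin 3))
    (X P : Finset (EuclideanSpace ℝ (Fin 3))) (R₀ h ρ : ℝ) (hρ : 1 ≤ ρ)
    (hX : ∀ p ∈ X, ∀ q ∈ X, p ≠ q → 1 ≤ dist p q) (hPX : P ⊆ X)
    (hP : ∀ p, p ∈ P ↔ (p ∈ (fun q => A q + t) '' fccStacking 1 (Real.sqrt (2 / 3)) ∧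
      h + R₀ ≤ p 2 ∧ p 2 ≤ h + 2 * R₀ ∧ p 0 ^ 2 + p 1 ^ 2 ≤ ρ ^ 2))
    (hcell : ∀ p ∈ X, p 2 ≤ h + 2 * R₀)
    {q : EuclideanSpace ℝ (Fin 3)} (hqX : q ∈ X)
    (hqΛ : q ∉ (fun q => A q + t) '' fccStacking 1 (Real.sqrt (2 / 3))) :
    q 2 < h + R₀ + 1 ∨ (ρ - 1) ^ 2 < q 0 ^ 2 + q 1 ^ 2 := by
  by_contra hcon
  push Not at hcon
  obtain ⟨hq2, hqr⟩ := hcon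
  have hmem := mem_sample_top_of_deep' A t X P R₀ h ρ hρ hX hPX hcell hP hqX hq2 hqr
  exact hqΛ ((hP q).1 hmem).1

/-- **(Sliver-free.) A non-rim top-sample ball touching a foreign ball carries no outer credit** (`R₀ ≥ 3`): for every
slot `w` with `⟪A w, e₃⟫ ≥ 0`, `p + A w ∈ P`. -/
theorem not_outerCredit_of_foreign_top'
    (A : EuclideanSpace ℝ (Fin 3) ≃ₗᵢ[ℝ] EuclideanSpace ℝ (Fin 3)) (t : EuclideanSpace ℝ (Fin 3))
    (X P : Finset (EuclideanSpace ℝ (Fin 3))) (R₀ h ρ : ℝ) (hR₀ : 3 ≤ R₀) (hρ : R₀ ≤ ρ)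
    (hX : ∀ p ∈ X, ∀ q ∈ X, p ≠ q → 1 ≤ dist p q) (hPX : P ⊆ X)
    (hP : ∀ p, p ∈ P ↔ (p ∈ (fun q => A q + t) '' fccStacking 1 (Real.sqrt (2 / 3)) ∧
      h + R₀ ≤ p 2 ∧ p 2 ≤ h + 2 * R₀ ∧ p 0 ^ 2 + p 1 ^ 2 ≤ ρ ^ 2))
    (hcell : ∀ p ∈ X, p 2 ≤ h + 2 * R₀)
    {p q : EuclideanSpace ℝ (Fin 3)} (hp : p ∈ P) (hprim : p 0 ^ 2 + p 1 ^ 2 ≤ (ρ - 2) ^ 2)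
    (hqX : q ∈ X) (hqΛ : q ∉ (fun q => A q + t) '' fccStacking 1 (Real.sqrt (2 / 3)))
    (hpq : dist p q = 1)
    {w : EuclideanSpace ℝ (Fin 3)} (hw : w ∈ fccSlots)
    (hα : 0 ≤ ⟪A w, EuclideanSpace.single (2 : Fin 3) (1 : ℝ)⟫_ℝ) : p + A w ∈ P := by
  have hρ1 : (1 : ℝ) ≤ ρ := by linarith
  have hρ2 : (0 : ℝ) ≤ ρ - 2 := by linarith
  obtain ⟨hpΛ, hp1, hp2, hp3⟩ := (hP p).1 hp
  have hsp : Real.sqrt (p 0 ^ 2 + p 1 ^ 2) ≤ ρ - 2 := by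
    rw [← Real.sqrt_sq hρ2]; exact Real.sqrt_le_sqrt hprim
  have hlatw : (p + A w) 0 ^ 2 + (p + A w) 1 ^ 2 ≤ ρ ^ 2 := by
    have h1 := sqrt_lateral_add_le p (A w)
    rw [LinearIsometryEquiv.norm_map, norm_eq_one_of_mem_fccSlots hw] at h1
    have h2 : Real.sqrt ((p + A w) 0 ^ 2 + (p + A w) 1 ^ 2) ≤ ρ := by linarith
    have h3 := Real.sq_sqrt (by positivity : (0 : ℝ) ≤ (p + A w) 0 ^ 2 + (p + A w) 1 ^ 2)
    have h4 : (0 : ℝ) ≤ Real.sqrt ((p + A w) 0 ^ 2 + (p + A w) 1 ^ 2) := Real.sqrt_nonneg _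
    nlinarith
  rcases foreign_low_or_rim_top' A t X P R₀ h ρ hρ1 hX hPX hP hcell hqX hqΛ with hq2 | hqr
  · -- `p₂ < h + R₀ + 2`, so `p + A w` is still inside the window
    have hpz : p 2 < h + R₀ + 2 := by
      have := abs_apply_sub_le_dist p q 2
      rw [hpq] at this
      have := (abs_le.1 this).2
      linarith
    have hα1 : ⟪A w, EuclideanSpace.single (2 : Fin 3) (1 : ℝ)⟫_ℝ ≤ 1 :=
      (abs_le.1 (abs_inner_slot_le_one A hw)).2
    have e2 : (p + A w) 2 = p 2 + ⟪A w, EuclideanSpace.single (2 : Fin 3) (1 : ℝ)⟫_ℝ := by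
      rw [PiLp.add_apply, apply_two_eq_inner_e₃ (A w)]
    rw [hP]
    refine ⟨movedFcc_add_site_mem A t hpΛ (mem_fcc_of_mem_fccSlots hw), ?_, ?_, hlatw⟩
    · rw [e2]; linarith
    · rw [e2]; linarith
  · exfalso
    have h1 := lateral_radius_le_add_dist q p
    rw [dist_comm, hpq] at h1
    have hq : ρ - 1 < Real.sqrt (q 0 ^ 2 + q 1 ^ 2) := by
      rw [← Real.sqrt_sq (by linarith : (0 : ℝ) ≤ ρ - 1)]
      exact Real.sqrt_lt_sqrt (sq_nonneg _) hqr
    linarith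

end Summit.Ventures.Crystal3D.Theorems

end
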